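import Summits.ValiantsHypothesis.ValiantsHypothesis.Theorems.NcCentralWidth
import Literature.Computability.AlgebraicComplexity.HI16DetSkewCircuitProofs
import HarnessLib

/-!
# The skew structure of a noncommutative circuit (Limaye–Malod–Srinivasan 2016, Lemma 5.2)

Workshop file for the node `CommutativityDial` (decomp-valiant lens 6, «restricted-models lifting
axis»; offer O-L6-11, FILE 1 of 2). The printed ladder of `CommutativityDial` reads: noncommutative
ABPs are exponentially weak for `PERM` (Nisan 1991; kernel: `NisanPermanent`) · noncommutative SKEW
circuits are exponentially weak (Limaye–Malod–Srinivasan 2016; print only) · general noncommutative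
circuits = the open half `A_nc`. This file and its sequel `NcSkewPermanent` move the SKEW rung into the
kernel.

A circuit is skew (`ArithCircuit.IsSkew`, Hüttenhain–Ikenmeyer's Definition, file `HI16BinaryDC`) when
every product gate has at most one operand referring to another gate. §1 is the SKEW SPAN
`skewSpan B d e a`: the `R`-span of the framed bodies `h · g · h̄` with `g ∈ B` of ONE fixed body degree
`e`, `h = h_r`, `h̄ = h̄_{a−e−r}` homogeneous, and its calculus (monotone, bodies, left/right
multiplication by homogeneous factors) — the degree bookkeeping is the automaton instrument `degPart`
of `NcCentralWidth`. §2 is the **SKEW STRUCTURE THEOREM in span form** (`skew_structure`, every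
commutative semiring, every alphabet): for every `2 ≤ e ≤ d`, a fan-in-two SKEW circuit value
homogeneous of degree `d` lies in the skew span, over the degree-`e` components of the circuit's OWN
gate values (`≤ size` bodies), of total degree `d` — Limaye–Malod–Srinivasan's Lemma 5.2 read on the
raw circuit: no homogenisation pass (their Lemma 4.1), no parse trees; the one graded invariant
«every component of degree `a ≥ e` of every gate value is in `skewSpan _ d e a`» is pushed through the
program, a skew product gate multiplying by a LETTER (degree `1`) or a SCALAR (degree `0`) on one side.
HONEST FRAMING: theorem in print (Limaye–Malod–Srinivasan, Theory of Computing 12 (2016), Lemma 5.2),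
new in the kernel; `VP ≠ VNP` and the open half `A_nc` (general noncommutative circuits) untouched.
-/

noncomputable section

namespace Summit.ValiantsHypothesis.ValiantsHypothesis.Theorems.NcSkewStructure

open Literature.Computability.AlgebraicComplexity
open Literature.Computability.AlgebraicComplexity.ArithCircuit
open Summit.ValiantsHypothesis.ValiantsHypothesis.Theorems.NcAutomatonIntersection
open Summit.ValiantsHypothesis.ValiantsHypothesis.Theorems.NcCentralWidth

universe u v

variable {R : Type u} [CommSemiring R] {σ : Type v}

/-! ## §1 Skew spans -/

/-- The SKEW SPAN of total degree `a` over the body set `B` of the fixed body degree `e`: the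
`R`-span of the framed bodies `h · g · h̄`, `g ∈ B`, `h = h_r`, `h̄ = h̄_{a−e−r}` homogeneous.
[cite: LimayeMalodSrinivasan2016, Lemma 5.2] -/
def skewSpan (B : Set (FreeAlgebra R σ)) (d e a : ℕ) : Submodule R (FreeAlgebra R σ) :=
  Submodule.span R {x | ∃ (r : ℕ) (g h hb : FreeAlgebra R σ), g ∈ B ∧ e + r ≤ a ∧
    degPart d r h = h ∧ degPart d (a - e - r) hb = hb ∧ x = h * g * hb}

/-- Skew spans grow with the body set. [cite: LimayeMalodSrinivasan2016, Lemma 5.2] -/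
theorem skewSpan_mono {B B' : Set (FreeAlgebra R σ)} (hBB : B ⊆ B') (d e a : ℕ) :
    skewSpan B d e a ≤ skewSpan B' d e a :=
  Submodule.span_mono fun _ ⟨r, g, h, hb, hg, her, hh, hhb, hx⟩ =>
    ⟨r, g, h, hb, hBB hg, her, hh, hhb, hx⟩

/-- A body is in the skew span of its own degree (`h = h̄ = 1`). [cite: LimayeMalodSrinivasan2016, Lemma 5.2] -/
theorem body_mem_skewSpan {B : Set (FreeAlgebra R σ)} {d e : ℕ} {g : FreeAlgebra R σ} (hg : g ∈ B) :
    g ∈ skewSpan B d e e :=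
  Submodule.subset_span ⟨0, g, 1, 1, hg, le_rfl, degPart_zero_one d,
    by rw [show e - e - 0 = 0 by omega]; exact degPart_zero_one d, by rw [one_mul, mul_one]⟩

/-- Right multiplication by `q = q_c`: total degree `a ↦ a + c ≤ d`. [cite: LimayeMalodSrinivasan2016, Lemma 5.2] -/
theorem skewSpan_mul_right {B : Set (FreeAlgebra R σ)} {d e a c : ℕ} {x q : FreeAlgebra R σ}
    (hx : x ∈ skewSpan B d e a) (hq : degPart d c q = q) (hac : a + c ≤ d) :
    x * q ∈ skewSpan B d e (a + c) := by
  have key : skewSpan B d e a ≤ (skewSpan B d e (a + c)).comap (LinearMap.mulRight R q) := by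
    refine Submodule.span_le.mpr ?_
    rintro _ ⟨r, g, h, hb, hg, her, hh, hhb, rfl⟩
    rw [SetLike.mem_coe, Submodule.mem_comap, LinearMap.mulRight_apply]
    refine Submodule.subset_span ⟨r, g, h, hb * q, hg, by omega, hh, ?_, mul_assoc _ _ _⟩
    have := degPart_mul_of_eq hhb hq (by omega)
    rwa [show a - e - r + c = a + c - e - r by omega] at this
  simpa only [Submodule.mem_comap, LinearMap.mulRight_apply] using key hx

/-- Left multiplication by `q = q_c`: total degree `a ↦ c + a ≤ d`. [cite: LimayeMalodSrinivasan2016, Lemma 5.2] -/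
theorem skewSpan_mul_left {B : Set (FreeAlgebra R σ)} {d e a c : ℕ} {x q : FreeAlgebra R σ}
    (hx : x ∈ skewSpan B d e a) (hq : degPart d c q = q) (hca : c + a ≤ d) :
    q * x ∈ skewSpan B d e (c + a) := by
  have key : skewSpan B d e a ≤ (skewSpan B d e (c + a)).comap (LinearMap.mulLeft R q) := by
    refine Submodule.span_le.mpr ?_
    rintro _ ⟨r, g, h, hb, hg, her, hh, hhb, rfl⟩
    rw [SetLike.mem_coe, Submodule.mem_comap, LinearMap.mulLeft_apply]
    refine Submodule.subset_span ⟨c + r, g, q * h, hb, hg, by omega,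
      degPart_mul_of_eq hq hh (by omega), ?_, by rw [← mul_assoc, ← mul_assoc]⟩
    rwa [show c + a - e - (c + r) = a - e - r by omega]
  simpa only [Submodule.mem_comap, LinearMap.mulLeft_apply] using key hx

/-! ## §2 The skew structure theorem -/

/-- An INPUT operand (a letter or a scalar — not a gate reference) has no component of degree
`2 ≤ c ≤ d`. [cite: LimayeMalodSrinivasan2016, Lemma 5.2] -/
theorem degPart_operand_eq_zero (vals : List (FreeAlgebra R σ)) {o : Operand R σ}
    (ho : o.isGateRef = false) {d c : ℕ} (hc : 2 ≤ c) (hcd : c ≤ d) :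
    degPart d c (o.ncEval vals) = 0 := by
  cases o with
  | var x => exact degPart_ι_eq_zero hc hcd x
  | const a => exact degPart_algebraMap_eq_zero (by omega) hcd a
  | gate i => exact absurd ho (by simp [Operand.isGateRef])

/-- Operands: letters/scalars vanish in degree `≥ e ≥ 2`; gate references inherit. [cite: LimayeMalodSrinivasan2016, Lemma 5.2] -/
theorem operand_mem_skewSpan {B : Set (FreeAlgebra R σ)} {d e : ℕ} (he : 2 ≤ e)
    (vals : List (FreeAlgebra R σ))
    (hvals : ∀ p ∈ vals, ∀ a, e ≤ a → a ≤ d → degPart d a p ∈ skewSpan B d e a)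
    (o : Operand R σ) {a : ℕ} (hea : e ≤ a) (had : a ≤ d) :
    degPart d a (o.ncEval vals) ∈ skewSpan B d e a := by
  cases o with
  | var x =>
    rw [show (Operand.var x : Operand R σ).ncEval vals = FreeAlgebra.ι R x from rfl,
      degPart_ι_eq_zero (by omega) had]
    exact zero_mem _
  | const c =>
    rw [show (Operand.const c : Operand R σ).ncEval vals = algebraMap R _ c from rfl,
      degPart_algebraMap_eq_zero (by omega) had]
    exact zero_mem _
  | gate i =>
    rw [ncEval_gate, List.getD_eq_getElem?_getD]
    by_cases hi : i < vals.length
    · rw [List.getElem?_eq_getElem hi, Option.getD_some]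
      exact hvals _ (List.getElem_mem hi) a hea had
    · rw [List.getElem?_eq_none_iff.mpr (Nat.le_of_not_lt hi), Option.getD_none, map_zero]
      exact zero_mem _

/-- **One skew gate** (fan-in `≤ 2`): the degree-`e` component IS a body; sums are linear; in a skew
product `u · u'` one factor is an input, of degree `≤ 1`, so every term of `(u u')_a = Σ_c u_c u'_{a−c}`
is a letter/scalar times a component of degree `≥ a − 1 ≥ e` of the other factor. [cite: LimayeMalodSrinivasan2016, Lemma 5.2] -/
theorem gate_mem_skewSpan {B : Set (FreeAlgebra R σ)} {d e : ℕ} (he : 2 ≤ e)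
    (vals : List (FreeAlgebra R σ))
    (hvals : ∀ p ∈ vals, ∀ a, e ≤ a → a ≤ d → degPart d a p ∈ skewSpan B d e a)
    (g : Gate R σ) (hg : g.fanIn ≤ 2) (hsk : g.IsSkew)
    (hbody : degPart d e (g.ncEval vals) ∈ B) {a : ℕ} (hea : e ≤ a) (had : a ≤ d) :
    degPart d a (g.ncEval vals) ∈ skewSpan B d e a := by
  rcases Nat.eq_or_lt_of_le hea with rfl | hlt
  · exact body_mem_skewSpan hbody
  clear hbody
  cases g with
  | sum args =>
    rw [show Gate.ncEval vals (Gate.sum args) = (args.map fun ca => ca.1 • ca.2.ncEval vals).sum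
      from rfl, map_list_sum, List.map_map]
    refine list_sum_mem fun x hx => ?_
    obtain ⟨⟨c, o⟩, -, rfl⟩ := List.mem_map.mp hx
    show degPart d a (c • o.ncEval vals) ∈ _
    rw [map_smul]
    exact Submodule.smul_mem _ c (operand_mem_skewSpan he vals hvals o hea had)
  | prod args =>
    match args, hg, hsk with
    | [], _, _ =>
      rw [show Gate.ncEval vals (Gate.prod []) = (1 : FreeAlgebra R σ) by simp [Gate.ncEval],
        ← map_one (algebraMap R (FreeAlgebra R σ)), degPart_algebraMap_eq_zero (by omega) had]
      exact zero_mem _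
    | [o], _, _ =>
      rw [show Gate.ncEval vals (Gate.prod [o]) = o.ncEval vals by simp [Gate.ncEval]]
      exact operand_mem_skewSpan he vals hvals o hea had
    | [o, o'], _, hsk =>
      have hcnt : [o, o'].countP Operand.isGateRef ≤ 1 := hsk
      have hoo : o.isGateRef = false ∨ o'.isGateRef = false := by
        cases ho : o.isGateRef
        · exact Or.inl rfl
        · cases ho' : o'.isGateRef
          · exact Or.inr rfl
          · exfalso
            rw [List.countP_cons, List.countP_cons, List.countP_nil, ho, ho'] at hcnt
            simp at hcnt
      rw [show Gate.ncEval vals (Gate.prod [o, o']) = o.ncEval vals * o'.ncEval vals by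
        simp [Gate.ncEval], degPart_mul d had]
      refine Submodule.sum_mem _ fun c _ => ?_
      split_ifs with hc
      · rcases hoo with ho | ho'
        · -- the LEFT factor is an input: only its components of degree `≤ 1` survive
          by_cases h2 : 2 ≤ c.1
          · rw [degPart_operand_eq_zero vals ho h2 (le_trans hc had), zero_mul]
            exact zero_mem _
          · have := skewSpan_mul_left
              (operand_mem_skewSpan he vals hvals o' (a := a - c.1) (by omega) (by omega))
              (degPart_idem d c.1 (o.ncEval vals)) (by omega)
            rwa [show c.1 + (a - c.1) = a by omega] at this
        · -- the RIGHT factor is an input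
          by_cases h2 : 2 ≤ a - c.1
          · rw [degPart_operand_eq_zero vals ho' h2 (by omega), mul_zero]
            exact zero_mem _
          · have := skewSpan_mul_right
              (operand_mem_skewSpan he vals hvals o (a := c.1) (by omega) (le_trans hc had))
              (degPart_idem d (a - c.1) (o'.ncEval vals)) (by omega)
            rwa [show c.1 + (a - c.1) = a by omega] at this
      · rw [mul_zero]
        exact zero_mem _
    | _ :: _ :: _ :: _, hg, _ => simp [Gate.fanIn, Gate.args] at hg

/-- **All gates** (reverse induction on the program): every component of degree `e ≤ a ≤ d` of every
gate value of a fan-in-two skew program lies in the skew span over the program's own degree-`e`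
bodies. [cite: LimayeMalodSrinivasan2016, Lemma 5.2] -/
theorem gates_mem_skewSpan {d e : ℕ} (he : 2 ≤ e) (gs : List (Gate R σ))
    (h2 : ∀ g ∈ gs, g.fanIn ≤ 2) (hsk : ∀ g ∈ gs, g.IsSkew) :
    ∀ p ∈ ncGateValues gs, ∀ a, e ≤ a → a ≤ d →
      degPart d a p ∈ skewSpan (bodies (ncGateValues gs) d e) d e a := by
  induction gs using List.reverseRecOn with
  | nil => intro p hp; simp [ncGateValues] at hp
  | append_singleton gs g ih =>
    have h2' : ∀ g' ∈ gs, g'.fanIn ≤ 2 := fun g' hg' => h2 g' (List.mem_append_left _ hg')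
    have hsk' : ∀ g' ∈ gs, g'.IsSkew := fun g' hg' => hsk g' (List.mem_append_left _ hg')
    have hg : g.fanIn ≤ 2 := h2 g (List.mem_append_right _ (List.mem_singleton_self g))
    have hgs : g.IsSkew := hsk g (List.mem_append_right _ (List.mem_singleton_self g))
    have hsub : ncGateValues gs ⊆ ncGateValues (gs ++ [g]) := by
      rw [ncGateValues_append_singleton]
      exact List.subset_append_left _ _
    have hmono : ∀ a, skewSpan (bodies (ncGateValues gs) d e) d e a ≤
        skewSpan (bodies (ncGateValues (gs ++ [g])) d e) d e a :=
      fun a => skewSpan_mono (bodies_mono hsub d e) d e a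
    intro p hp a hea had
    have hp' := hp
    rw [ncGateValues_append_singleton, List.mem_append, List.mem_singleton] at hp'
    rcases hp' with hp' | rfl
    · exact hmono a (ih h2' hsk' p hp' a hea had)
    · exact gate_mem_skewSpan he (ncGateValues gs)
        (fun p hp a hea had => hmono a (ih h2' hsk' p hp a hea had)) g hg hgs
        ⟨g.ncEval (ncGateValues gs), hp, rfl⟩ hea had

/-- **SKEW STRUCTURE THEOREM, SPAN FORM** (Limaye–Malod–Srinivasan's Lemma 5.2 on the raw circuit,
every commutative semiring): for every body degree `2 ≤ e ≤ d`, a fan-in-two SKEW circuit value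
homogeneous of degree `d` is an `R`-combination of framed bodies `h · g · h̄` — bodies `g` the
degree-`e` components of its own gate values, frames `h, h̄` homogeneous.
[cite: LimayeMalodSrinivasan2016, Lemma 5.2] -/
theorem skew_structure (P : ArithCircuit R σ) (hP : P.IsFanInTwo) (hS : P.IsSkew) {d e : ℕ}
    (he : 2 ≤ e) (hed : e ≤ d) (hf : degPart d d P.ncEval = P.ncEval) :
    P.ncEval ∈ skewSpan (bodies (ncGateValues P.gates) d e) d e d := by
  rw [← hf]
  exact operand_mem_skewSpan he (ncGateValues P.gates) (gates_mem_skewSpan he P.gates hP hS) P.output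
    hed le_rfl

/-- **SIZE FORM**: the bodies are the degree-`e` components of `≤ P.size` values.
[cite: LimayeMalodSrinivasan2016, Lemma 5.2] -/
theorem skew_structure_size (P : ArithCircuit R σ) (hP : P.IsFanInTwo) (hS : P.IsSkew) {d e : ℕ}
    (he : 2 ≤ e) (hed : e ≤ d) (hf : degPart d d P.ncEval = P.ncEval) :
    ∃ vals : List (FreeAlgebra R σ), vals.length = P.size ∧
      P.ncEval ∈ skewSpan (bodies vals d e) d e d :=
  ⟨ncGateValues P.gates, by
    show (ncGateValues P.gates).length = P.gates.length
    simpa using (ncGateValues_append_getD P.gates []).1, skew_structure P hP hS he hed hf⟩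

end Summit.ValiantsHypothesis.ValiantsHypothesis.Theorems.NcSkewStructure

end
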